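import Summits.Ventures.PercRepro.RankLevelSetLevelSixHeavyCell
import Summits.Ventures.PercRepro.RankLevelSetDepCountHeavySq
import Summits.Ventures.PercRepro.RankLevelSetDepCountHeavyCap
import Summits.Ventures.PercRepro.RankLevelSetTripleMultCount
import Summits.Ventures.PercRepro.RankLevelSetCoreCircuitBounds
import Summits.Ventures.PercRepro.RankLevelSetLevelSix
import Summits.Ventures.PercRepro.S1FourCircuitCount
import Summits.Ventures.PercRepro.RankLevelSetPlaneSix
import Summits.Ventures.PercRepro.S1TriangleCount
import Summits.Ventures.PercRepro.RankLevelSetTriangleStar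
import Summits.Ventures.PercRepro.RankLevelSetCorankFiveCounts
import Summits.Ventures.PercRepro.RankLevelSetPlaneTen
import Summits.Ventures.PercRepro.RankLevelSetPlaneTenPrime
import Summits.Ventures.PercRepro.S1TrianglePlusPlus
import Summits.Ventures.PercRepro.RankLevelSetLowRankCount
import Summits.Ventures.PercRepro.RankLevelSetDepCountHeavyU
import Summits.Ventures.PercRepro.RankLevelSetCoreFour
import Summits.Ventures.PercRepro.RankLevelSetFrameLarge
import Summits.Ventures.PercRepro.RankLevelSetFrameQM
import Summits.Ventures.PercRepro.RankLevelSetLevelFiveAll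
import Summits.Ventures.PercRepro.RankLevelSetLevelSixGiant

/-!
# PercRepro — THE HEAVY / LIGHT COUNT AT LEVEL `6` WITH THE TRIPLE MULTIPLICITY, THE DISJOINT PAIR COUNT AND THE SIZE-CAPPED
HEAVY TERM: ONE CORE CELL, THE CIRCUIT BOUNDS AS HYPOTHESES (p8 g4, S3)

`proofs/SUBCLAIM-S3-p8.md` §3q. The cell theorem `c025_core_six_heavy_cell_sq33d` of RankLevelSetLevelSixHeavyCellSq33D (§3p) with THE
TRIPLE MULTIPLICITY (RankLevelSetTripleMultCount: the fibre weights `2/((j + 1)(3j + 2))` in place of `1/(j + 1)²`, from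
`S2.card_spanF_ge_tri` under the line bound of the core); that cell = `c025_core_six_heavy_cell_sq35q` of RankLevelSetLevelSixHeavyCellSq35Q
(flat bounds `39 / 19`, the square multiplicity, rational tails `Kn/Kd` in the nullity-cap, the flat-count or the U-count
form, the unique heavy flat) re-cut on the two devices of RankLevelSetDepCountHeavyCap, with NO new matroid input:
(i) THE DISJOINT PAIR COUNT — the pairs `(C, B′)` with a `k`-circuit number `≤ s_k·C(n − k, 7 − k)`
(`Matroid.card_pairsF_le_disj`), so the pair polynomial reads `P(n) = s₃·C(n − 3, 4) + s₄·C(n − 4, 3) + s₅·C(n − 5, 2) +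
s₆·(n − 6) + s₇`; (ii) THE SIZE-CAPPED HEAVY COUNT — the heavy sets of the `U`-count have `≤ d` elements and those of the
rank-`6` tail count `≤ min 39 (6 + d)`, so the heavy term is `Σ_{j ≤ c} C(uG, j) + (n + 1)·Σ_{j ≤ c} C(uH, j)` in place of
`2^{uG} + (n + 1)·2^{uH}` (`Matroid.ncard_heavy_le_cap`, `Matroid.ncard_eRk_eq_ncard_le_le_heavy_sq_cap`). The triangle and
4-circuit bounds enter as HYPOTHESES `hs3 : s₃ ≤ c3`, `hs4 : s₄ ≤ c4` (the dispatchers discharge them from the tree's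
LEMMA T⁺⁺ / T4 — RankLevelSetCoreCircuitBounds — or from p2's LEMMA Q, p1's LEMMA T⁺⁺⁺ and the 4-circuit table);
`s_k ≤ C(d + k − 1, k)` for `k = 5, 6, 7` as before. With tree facts only the row closes
at `p ≥ 34`; with p1's / p2's levers at `p ≥ 32` (`proofs/SUBCLAIM-S3-p8.md` §3q). Axioms: standard.
-/

open scoped Matroid

namespace PercRepro

namespace ThmN

open Set

variable {α : Type}

/-- **ONE CORE CELL AT LEVEL `6`, SQUARE MULTIPLICITY, RATIONAL TAIL `Kn/Kd`, THE DISJOINT PAIR COUNT AND THE SIZE-CAPPED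
HEAVY TERM.** Parameters: the nullity threshold `ν₁ ≥ 7`, the rank jumps `j` (rank-`6` flats) and `j′` (rank-`5` flats) with
`d + cnull(5 − j) + 1 ≤ 2ν₁` and `d + cnull(4 − j′) + 1 ≤ 2ν₁`, the exponents `uG ≥ 6 + (j+1)d − jν₁` (or `uG ≥ min 39 (6 + d)`
when `2ν₁ ≥ d + 15`: the unique heavy flat), `uH` (from the plain union bound, the unique-flat bound `f′ = min 19 (5 + d)`, or
the empty case), `b ∈ {0, 1}` with `b = 0` only when `6 + ν₁ ≤ f′ + 2` (no light big pair); the tail's `a ≥ min 39 (6 + d)`,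
or the flat-count form, or the U-count form; the circuit bounds `s₃ ≤ c3`, `s₄ ≤ c4` as hypotheses. The count:
`U ≤ C(n, 6) + σ₁²·P(n) + b·σ₂²·P(n) + Σ_{j ≤ d} C(uG, j) + (n + 1)·Σ_{j ≤ d} C(uH, j)` with
`P(n) = c3·C(n − 3, 4) + c4·C(n − 4, 3) + C(d + 4, 5)·C(n − 5, 2) + C(d + 5, 6)·(n − 6) + C(d + 6, 7)`. -/
theorem c025_core_six_heavy_cell_sq32t (M : Matroid α) [M.Finite] (p d ν₁ j j' uG uH b Kn Kd a c4 c3 : ℕ) (hd7 : 7 ≤ d)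
    (hd50 : d ≤ 51) (hν7 : 7 ≤ ν₁) (hj : 1 ≤ j) (hj5 : j ≤ 5) (hj' : 1 ≤ j') (hj'4 : j' ≤ 4)
    (hνj : d + cnull (5 - j) + 1 ≤ 2 * ν₁) (hνj' : d + cnull (4 - j') + 1 ≤ 2 * ν₁)
    (huG : 6 + (j + 1) * d ≤ uG + j * ν₁ ∨ (d + 14 + 1 ≤ 2 * ν₁ ∧ min 39 (6 + d) ≤ uG))
    (huH : 5 + (j' + 1) * d ≤ uH + j' * ν₁ ∨ (d + 7 ≤ 2 * ν₁ ∧ min 19 (5 + d) ≤ uH) ∨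
      min 19 (5 + d) + 1 ≤ 5 + ν₁)
    (hb : 6 + ν₁ ≤ min 19 (5 + d) + 2 ∨ b = 1) (hK : Kd < Kn) (hKd : 0 < Kd) (ha : min 39 (6 + d) ≤ a)
    (hs3 : {C | M.IsCircuit C ∧ C.ncard = 3}.ncard ≤ c3) (hs4 : {C | M.IsCircuit C ∧ C.ncard = 4}.ncard ≤ c4)
    (htail : Kn * (∑ j ∈ Finset.range (a + 1), (p + d).choose j + ∑ j ∈ Finset.range (d + 1), (p + d).choose j) ≤
        Kd * 2 ^ (p + d) ∨
      Kn * (∑ j ∈ Finset.range (19 + 1), (p + d).choose j + 2 ^ (39 - 6) * ∑ j ∈ Finset.range (6 + 1), (p + d).choose j +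
        ∑ j ∈ Finset.range (d + 1), (p + d).choose j) ≤ Kd * 2 ^ (p + d) ∨
      (Kn : ℚ) * ((∑ j ∈ Finset.range (min 19 (5 + d) + 1), (((p + d).choose j : ℕ) : ℚ)) +
        ((((p + d).choose 6 : ℕ) : ℚ) +
          ((∑ i ∈ Finset.range (min 39 (6 + d) - 7 + 1), ((Nat.choose (min (min 19 (5 + d) - 6) (ν₁ - 2)) i : ℕ) : ℚ) * (2 / (((i : ℚ) + 1) * (3 * (i : ℚ) + 2)))) *
            (((c3 : ℕ) : ℚ) * ((p + d - 3).choose 4 : ℚ) + ((c4 : ℕ) : ℚ) * ((p + d - 4).choose 3 : ℚ) +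
          (((d + 4).choose 5 : ℕ) : ℚ) * ((p + d - 5).choose 2 : ℚ) + (((d + 5).choose 6 : ℕ) : ℚ) * ((p + d - 6 : ℕ) : ℚ) +
          (((d + 6).choose 7 : ℕ) : ℚ)) +
          ((b : ℕ) : ℚ) * (∑ i ∈ Finset.range (min 39 (6 + d) - 7 + 1), ((Nat.choose (ν₁ - 2) i : ℕ) : ℚ) * (2 / (((i : ℚ) + 1) * (3 * (i : ℚ) + 2)))) *
            (((c3 : ℕ) : ℚ) * ((p + d - 3).choose 4 : ℚ) + ((c4 : ℕ) : ℚ) * ((p + d - 4).choose 3 : ℚ) +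
          (((d + 4).choose 5 : ℕ) : ℚ) * ((p + d - 5).choose 2 : ℚ) + (((d + 5).choose 6 : ℕ) : ℚ) * ((p + d - 6 : ℕ) : ℚ) +
          (((d + 6).choose 7 : ℕ) : ℚ)) +
          (∑ i ∈ Finset.range (min 39 (6 + d) + 1), ((Nat.choose uG i : ℕ) : ℚ)) +
          (((p + d : ℕ) : ℚ) + 1) * (∑ i ∈ Finset.range (min 39 (6 + d) + 1), ((Nat.choose uH i : ℕ) : ℚ))) +
        (∑ j ∈ Finset.range (d + 1), (((p + d).choose j : ℕ) : ℚ)))) ≤ Kd * 2 ^ (p + d))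
    (hR : M.eRank = (p : ℕ∞)) (hn : M.E.ncard = p + d)
    (hfree : ∀ e ∈ M.E, ∃ A ⊆ M.E \ {e}, e ∉ M.closure A ∧ e ∉ M.closure ((M.E \ {e}) \ A))
    (hpoly : (Kn : ℚ) * ((((p + d).choose 6 : ℕ) : ℚ) +
      ((∑ i ∈ Finset.range (d - 7 + 1), ((Nat.choose (min (min 19 (5 + d) - 6) (ν₁ - 2)) i : ℕ) : ℚ) * (2 / (((i : ℚ) + 1) * (3 * (i : ℚ) + 2)))) *
        (((c3 : ℕ) : ℚ) * ((p + d - 3).choose 4 : ℚ) + ((c4 : ℕ) : ℚ) * ((p + d - 4).choose 3 : ℚ) +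
          (((d + 4).choose 5 : ℕ) : ℚ) * ((p + d - 5).choose 2 : ℚ) + (((d + 5).choose 6 : ℕ) : ℚ) * ((p + d - 6 : ℕ) : ℚ) +
          (((d + 6).choose 7 : ℕ) : ℚ)) +
      ((b : ℕ) : ℚ) * (∑ i ∈ Finset.range (d - 7 + 1), ((Nat.choose (ν₁ - 2) i : ℕ) : ℚ) * (2 / (((i : ℚ) + 1) * (3 * (i : ℚ) + 2)))) *
        (((c3 : ℕ) : ℚ) * ((p + d - 3).choose 4 : ℚ) + ((c4 : ℕ) : ℚ) * ((p + d - 4).choose 3 : ℚ) +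
          (((d + 4).choose 5 : ℕ) : ℚ) * ((p + d - 5).choose 2 : ℚ) + (((d + 5).choose 6 : ℕ) : ℚ) * ((p + d - 6 : ℕ) : ℚ) +
          (((d + 6).choose 7 : ℕ) : ℚ)) +
      (∑ i ∈ Finset.range (d + 1), ((Nat.choose uG i : ℕ) : ℚ)) +
          (((p + d : ℕ) : ℚ) + 1) * (∑ i ∈ Finset.range (d + 1), ((Nat.choose uH i : ℕ) : ℚ)))) ≤
      ((Kn - Kd : ℕ) : ℚ) * 2 ^ (d - 6) * (((p + 6).choose 6 : ℕ) : ℚ)) :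
    RLS M p 6 := by
  classical
  have hEcard : M.ground_finite.toFinset.card = p + d := by
    rw [← Set.ncard_eq_toFinset_card _ M.ground_finite]; exact hn
  -- the core is simple: every circuit has `≥ 3` elements
  have hL : ∀ e ∈ M.E, ¬ M.IsLoop e := not_isLoop_of_free M hfree
  have hs : ∀ e ∈ M.E, ∀ f ∈ M.E, e ≠ f → M.eRk {e, f} = 2 := by
    intro e he f hf hef
    have h2 : (2 : ℕ∞) ≤ M.eRk {e, f} :=
      two_le_eRk_of_two_le_ncard_of_free M hfree (pair_subset he hf) (by rw [ncard_pair hef])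
    have h3 : M.eRk {e, f} ≤ 2 := by
      have := M.eRk_le_encard {e, f}
      rwa [encard_pair hef] at this
    exact le_antisymm h3 h2
  have hcirc : ∀ C, M.IsCircuit C → 3 ≤ C.encard := three_le_encard_of_circuit M hL hs
  have hC1 : ∀ L ⊆ M.E, M.eRk L = 2 → L.ncard ≤ 3 :=
    fun L hL hr => ncard_le_three_of_eRk_two M hs hfree hL hr
  have hd : M.E.encard = M.eRank + d := by
    rw [hR, ← M.ground_finite.cast_ncard_eq, hn]
    push_cast
    ring
  -- the nullity cap: every `X ⊆ E` has `|X| ≤ r(X) + d`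
  have hcap : ∀ X ⊆ M.E, ∀ k : ℕ, M.eRk X ≤ k → X.ncard ≤ k + d := by
    intro X hX k hr
    have h1 := Matroid.encard_le_eRk_add_of_encard_eq hX hd
    have h2 : X.encard ≤ (k : ℕ∞) + d := h1.trans (by gcongr)
    have hfin : X.Finite := M.ground_finite.subset hX
    rw [← hfin.cast_ncard_eq] at h2
    exact_mod_cast h2
  have hflat : ∀ X ⊆ M.E, M.eRk X ≤ 6 → X.ncard ≤ min 39 (6 + d) :=
    fun X hX hr => le_min (ncard_le_thirtynine_of_eRk_le_six_of_free M hfree hX hr) (hcap X hX 6 hr)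
  have hflat' : ∀ X ⊆ M.E, M.eRk X ≤ ((6 - 1 : ℕ) : ℕ∞) → X.ncard ≤ min 19 (5 + d) :=
    fun X hX hr => le_min (ncard_le_nineteen_of_eRk_le_five_of_free M hfree hX (by simpa using hr))
      (hcap X hX 5 (by simpa using hr))
  -- the small-rank nullity caps
  have hc : ∀ X ⊆ M.E, M.eRk X ≤ ((6 - 2 : ℕ) : ℕ∞) → (X.ncard : ℕ∞) ≤ M.eRk X + cnull 4 :=
    fun X hX hr => nullity_cap_core M hfree 4 (le_refl 4) X hX (by simpa using hr)
  have hc6 : cnull 4 + 1 ≤ ν₁ := by simp [cnull]; omega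
  have hcj : ∀ X ⊆ M.E, M.eRk X ≤ ((6 - j - 1 : ℕ) : ℕ∞) → (X.ncard : ℕ∞) ≤ M.eRk X + cnull (5 - j) :=
    fun X hX hr => nullity_cap_core M hfree (5 - j) (by omega) X hX
      (by rwa [show (6 - j - 1 : ℕ) = 5 - j by omega] at hr)
  have hcj' : ∀ X ⊆ M.E, M.eRk X ≤ ((6 - 1 - j' - 1 : ℕ) : ℕ∞) → (X.ncard : ℕ∞) ≤ M.eRk X + cnull (4 - j') :=
    fun X hX hr => nullity_cap_core M hfree (4 - j') (by omega) X hX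
      (by rwa [show (6 - 1 - j' - 1 : ℕ) = 4 - j' by omega] at hr)
  -- (U): the heavy / light count with the size-capped heavy term
  have hU1 := Matroid.topCount_le_ncard_compl (M := M) hR hd 6
  have hG := Matroid.ncard_eRk_eq_ncard_le_le_heavy_tri_cap M 6 (min 19 (5 + d)) ν₁ (by norm_num) hcirc hC1 d
  -- the pair classes, by the DISJOINT pair count
  have hPs : (((Matroid.pairsLight M 6 ν₁).filter (fun p => p ∈ Matroid.pairsSmall M 6 (min 19 (5 + d)))).card : ℚ) ≤
      ∑ k ∈ Finset.Icc 3 (6 + 1), ({C | M.IsCircuit C ∧ C.ncard = k}.ncard : ℚ) * (((M.E.ncard - k).choose (6 + 1 - k) : ℕ) : ℚ) := by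
    have h1 := (Matroid.card_pairsLightSmall_le (M := M) 6 (min 19 (5 + d)) ν₁).trans (Matroid.card_pairsF_le_disj 6)
    have : ((((Matroid.pairsLight M 6 ν₁).filter (fun p => p ∈ Matroid.pairsSmall M 6 (min 19 (5 + d)))).card : ℕ) : ℚ) ≤
        ((∑ k ∈ Finset.Icc 3 (6 + 1), {C | M.IsCircuit C ∧ C.ncard = k}.ncard * (M.E.ncard - k).choose (6 + 1 - k) : ℕ) : ℚ) := by
      exact_mod_cast h1
    push_cast at this
    exact this
  have hPb : (((Matroid.pairsLight M 6 ν₁).filter (fun p => p ∉ Matroid.pairsSmall M 6 (min 19 (5 + d)))).card : ℚ) ≤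
      ((b : ℕ) : ℚ) * ∑ k ∈ Finset.Icc 3 (6 + 1), ({C | M.IsCircuit C ∧ C.ncard = k}.ncard : ℚ) * (((M.E.ncard - k).choose (6 + 1 - k) : ℕ) : ℚ) := by
    rcases hb with hb0 | hb1
    · rw [Matroid.card_pairsBigLight_eq_zero 6 (min 19 (5 + d)) ν₁ hb0]
      have : (0 : ℚ) ≤ ((b : ℕ) : ℚ) * ∑ k ∈ Finset.Icc 3 (6 + 1), ({C | M.IsCircuit C ∧ C.ncard = k}.ncard : ℚ) *
          (((M.E.ncard - k).choose (6 + 1 - k) : ℕ) : ℚ) := by positivity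
      simpa using this
    · rw [hb1]
      push_cast
      rw [one_mul]
      have h1 := (Matroid.card_pairsBigLight_le (M := M) 6 (min 19 (5 + d)) ν₁).trans (Matroid.card_pairsF_le_disj 6)
      have : ((((Matroid.pairsLight M 6 ν₁).filter (fun p => p ∉ Matroid.pairsSmall M 6 (min 19 (5 + d)))).card : ℕ) : ℚ) ≤
          ((∑ k ∈ Finset.Icc 3 (6 + 1), {C | M.IsCircuit C ∧ C.ncard = k}.ncard * (M.E.ncard - k).choose (6 + 1 - k) : ℕ) : ℚ) := by
        exact_mod_cast h1
      push_cast at this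
      exact this
  -- the heavy sets
  have hUG : (Matroid.UG M 6 ν₁).ncard ≤ uG := by
    rcases huG with huG | ⟨hu1, hu2⟩
    · have := Matroid.ncard_UG_le (M := M) (q := 6) (ν₁ := ν₁) (j := j) (by norm_num) hd hc hc6 hcj hνj
      omega
    · exact (Matroid.ncard_UG_le_of_unique (M := M) (q := 6) (ν₁ := ν₁) hd (nullity_cap_core_five M hfree) hu1
        (fun X hX hr => hflat X hX (by simpa using hr))).trans hu2
  have hUH : (Matroid.UH M 6 ν₁).ncard ≤ uH := by
    rcases huH with h | ⟨h1, h2⟩ | h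
    · have := Matroid.ncard_UH_le (M := M) (q := 6) (ν₁ := ν₁) (j' := j') (by norm_num) hd hc hc6 hcj' hνj'
      omega
    · have hνc : d + cnull 4 + 1 ≤ 2 * ν₁ := by simp [cnull]; omega
      exact (Matroid.ncard_UH_le_of_unique (M := M) (q := 6) hd hc hνc hflat').trans h2
    · rw [Matroid.UH_eq_empty (M := M) (q := 6) (ν₁ := ν₁) hflat' (by omega)]
      simp
  -- the size-capped heavy count at any cap `c`
  have hHvc : ∀ c : ℕ, ({B : Set α | B ⊆ M.E ∧ M.eRk B = (6 : ℕ) ∧ 6 + ν₁ ≤ (M.closure B).ncard ∧ B.ncard ≤ c}.ncard : ℚ) ≤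
      (∑ i ∈ Finset.range (c + 1), ((Nat.choose uG i : ℕ) : ℚ)) +
        (((p + d : ℕ) : ℚ) + 1) * (∑ i ∈ Finset.range (c + 1), ((Nat.choose uH i : ℕ) : ℚ)) := by
    intro c
    have h1 := Matroid.ncard_heavy_le_cap (M := M) 6 ν₁ c
    have h2 : ∑ i ∈ Finset.range (c + 1), (Matroid.UG M 6 ν₁).ncard.choose i +
        (M.E.ncard + 1) * ∑ i ∈ Finset.range (c + 1), (Matroid.UH M 6 ν₁).ncard.choose i ≤
        ∑ i ∈ Finset.range (c + 1), uG.choose i + (p + d + 1) * ∑ i ∈ Finset.range (c + 1), uH.choose i := by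
      rw [hn]
      exact Nat.add_le_add (Finset.sum_le_sum (fun i _ => Nat.choose_le_choose i hUG))
        (Nat.mul_le_mul_left _ (Finset.sum_le_sum (fun i _ => Nat.choose_le_choose i hUH)))
    exact_mod_cast h1.trans h2
  have hHv := hHvc d
  -- the circuit bounds
  have hs5 : {C | M.IsCircuit C ∧ C.ncard = 5}.ncard ≤ (d + 4).choose 5 :=
    Matroid.ncard_circuits_le_choose_of_encard M hd 4
  have hs6 : {C | M.IsCircuit C ∧ C.ncard = 6}.ncard ≤ (d + 5).choose 6 :=
    Matroid.ncard_circuits_le_choose_of_encard M hd 5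
  have hs7 : {C | M.IsCircuit C ∧ C.ncard = 7}.ncard ≤ (d + 6).choose 7 :=
    Matroid.ncard_circuits_le_choose_of_encard M hd 6
  have hs3q : ({C | M.IsCircuit C ∧ C.ncard = 3}.ncard : ℚ) ≤ ((c3 : ℕ) : ℚ) := by exact_mod_cast hs3
  have hs4q : ({C | M.IsCircuit C ∧ C.ncard = 4}.ncard : ℚ) ≤ ((c4 : ℕ) : ℚ) := by exact_mod_cast hs4
  have hs5q : ({C | M.IsCircuit C ∧ C.ncard = 5}.ncard : ℚ) ≤ (((d + 4).choose 5 : ℕ) : ℚ) := by exact_mod_cast hs5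
  have hs6q : ({C | M.IsCircuit C ∧ C.ncard = 6}.ncard : ℚ) ≤ (((d + 5).choose 6 : ℕ) : ℚ) := by exact_mod_cast hs6
  have hs7q : ({C | M.IsCircuit C ∧ C.ncard = 7}.ncard : ℚ) ≤ (((d + 6).choose 7 : ℕ) : ℚ) := by exact_mod_cast hs7
  -- the pair sum in explicit form
  have hPexp : ∑ k ∈ Finset.Icc 3 (6 + 1), ({C | M.IsCircuit C ∧ C.ncard = k}.ncard : ℚ) * (((M.E.ncard - k).choose (6 + 1 - k) : ℕ) : ℚ) ≤
      ((c3 : ℕ) : ℚ) * ((p + d - 3).choose 4 : ℚ) + ((c4 : ℕ) : ℚ) * ((p + d - 4).choose 3 : ℚ) +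
          (((d + 4).choose 5 : ℕ) : ℚ) * ((p + d - 5).choose 2 : ℚ) + (((d + 5).choose 6 : ℕ) : ℚ) * ((p + d - 6 : ℕ) : ℚ) +
          (((d + 6).choose 7 : ℕ) : ℚ) := by
    rw [show (6 : ℕ) + 1 = 7 from rfl, sum_Icc_three_seven_q, hn]
    simp only [show (7 : ℕ) - 3 = 4 from rfl, show (7 : ℕ) - 4 = 3 from rfl, show (7 : ℕ) - 5 = 2 from rfl,
      show (7 : ℕ) - 6 = 1 from rfl, show (7 : ℕ) - 7 = 0 from rfl, Nat.choose_one_right, Nat.choose_zero_right,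
      mul_one, Nat.cast_one]
    gcongr
  set Pq := ((c3 : ℕ) : ℚ) * ((p + d - 3).choose 4 : ℚ) + ((c4 : ℕ) : ℚ) * ((p + d - 4).choose 3 : ℚ) +
          (((d + 4).choose 5 : ℕ) : ℚ) * ((p + d - 5).choose 2 : ℚ) + (((d + 5).choose 6 : ℕ) : ℚ) * ((p + d - 6 : ℕ) : ℚ) +
          (((d + 6).choose 7 : ℕ) : ℚ) with hPq
  have hσ1 : (0 : ℚ) ≤ ∑ i ∈ Finset.range (d - (6 + 1) + 1), ((Nat.choose (min (min 19 (5 + d) - 6) (ν₁ - 2)) i : ℕ) : ℚ) * (2 / (((i : ℚ) + 1) * (3 * (i : ℚ) + 2))) :=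
    Finset.sum_nonneg (fun i _ => by positivity)
  have hσ2 : (0 : ℚ) ≤ ∑ i ∈ Finset.range (d - (6 + 1) + 1), ((Nat.choose (ν₁ - 2) i : ℕ) : ℚ) * (2 / (((i : ℚ) + 1) * (3 * (i : ℚ) + 2))) :=
    Finset.sum_nonneg (fun i _ => by positivity)
  have hUq : (Matroid.topCount M p 6 : ℚ) ≤ ((p + d).choose 6 : ℚ) +
      ((∑ i ∈ Finset.range (d - 7 + 1), ((Nat.choose (min (min 19 (5 + d) - 6) (ν₁ - 2)) i : ℕ) : ℚ) * (2 / (((i : ℚ) + 1) * (3 * (i : ℚ) + 2)))) * Pq +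
        ((b : ℕ) : ℚ) * (∑ i ∈ Finset.range (d - 7 + 1), ((Nat.choose (ν₁ - 2) i : ℕ) : ℚ) * (2 / (((i : ℚ) + 1) * (3 * (i : ℚ) + 2)))) * Pq +
        (∑ i ∈ Finset.range (d + 1), ((Nat.choose uG i : ℕ) : ℚ)) +
          (((p + d : ℕ) : ℚ) + 1) * (∑ i ∈ Finset.range (d + 1), ((Nat.choose uH i : ℕ) : ℚ))) := by
    have h1 : (Matroid.topCount M p 6 : ℚ) ≤
        ({B : Set α | B ⊆ M.E ∧ M.eRk B = 6 ∧ B.ncard ≤ d}.ncard : ℚ) := by exact_mod_cast hU1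
    refine h1.trans (hG.trans ?_)
    have e1 := mul_le_mul_of_nonneg_left (hPs.trans hPexp) hσ1
    have e2 := mul_le_mul_of_nonneg_left (hPb.trans (mul_le_mul_of_nonneg_left hPexp (by positivity))) hσ2
    simp only [show (6 : ℕ) + 1 = 7 from rfl] at e1 e2 ⊢
    rw [hn]
    have h3 := add_le_add (add_le_add (add_le_add (le_refl (((p + d).choose 6 : ℕ) : ℚ)) e1) e2) hHv
    refine h3.trans (le_of_eq ?_)
    ring
  -- (Y)
  have hY := Matroid.two_pow_le_midCount_add (M := M) p 6 hR
  have hA : {X : Set α | X ⊆ M.E ∧ M.eRk X ≤ 6}.ncard ≤ ∑ j ∈ Finset.range (a + 1), (p + d).choose j := by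
    calc {X : Set α | X ⊆ M.E ∧ M.eRk X ≤ 6}.ncard
        ≤ {X : Set α | X ⊆ (M.ground_finite.toFinset : Set α) ∧ X.ncard ≤ a}.ncard := by
          apply ncard_le_ncard
          · intro X hX
            exact ⟨by rw [Set.Finite.coe_toFinset]; exact hX.1, (hflat X hX.1 hX.2).trans ha⟩
          · exact (Finset.finite_toSet _).finite_subsets.subset (fun X hX => hX.1)
      _ ≤ ∑ j ∈ Finset.range (a + 1), M.ground_finite.toFinset.card.choose j :=
          ncard_subsets_ncard_le _ a
      _ = ∑ j ∈ Finset.range (a + 1), (p + d).choose j := by rw [hEcard]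
  -- the flat-count bound of the rank-`≤ 6` sets: rank `≤ 5` sets have `≤ 19` points, rank-`6` sets are `≤ C(n, 6)·2^{33}`
  have hA' : {X : Set α | X ⊆ M.E ∧ M.eRk X ≤ 6}.ncard ≤
      ∑ j ∈ Finset.range (19 + 1), (p + d).choose j + 2 ^ (39 - 6) * ∑ j ∈ Finset.range (6 + 1), (p + d).choose j := by
    have hsub : {X : Set α | X ⊆ M.E ∧ M.eRk X ≤ 6} ⊆
        {X : Set α | X ⊆ (M.ground_finite.toFinset : Set α) ∧ X.ncard ≤ 19} ∪ {X : Set α | X ⊆ M.E ∧ M.eRk X = 6} := by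
      intro X hX
      rcases eq_or_ne (M.eRk X) 6 with h6 | h6
      · exact Or.inr ⟨hX.1, h6⟩
      · left
        refine ⟨by rw [Set.Finite.coe_toFinset]; exact hX.1, ?_⟩
        have hlt : M.eRk X < 6 := lt_of_le_of_ne hX.2 h6
        have h5 : M.eRk X ≤ ((6 - 1 : ℕ) : ℕ∞) := by
          have h51 : (6 : ℕ∞) = (5 : ℕ∞) + 1 := by norm_num
          rw [h51, ENat.lt_add_one_iff (by simp)] at hlt
          simpa using hlt
        exact (hflat' X hX.1 h5).trans (min_le_left _ _)
    have hfin1 : {X : Set α | X ⊆ (M.ground_finite.toFinset : Set α) ∧ X.ncard ≤ 19}.Finite :=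
      (Finset.finite_toSet _).finite_subsets.subset (fun X hX => hX.1)
    have hfin2 : {X : Set α | X ⊆ M.E ∧ M.eRk X = 6}.Finite :=
      M.ground_finite.finite_subsets.subset (fun X hX => hX.1)
    calc {X : Set α | X ⊆ M.E ∧ M.eRk X ≤ 6}.ncard
        ≤ ({X : Set α | X ⊆ (M.ground_finite.toFinset : Set α) ∧ X.ncard ≤ 19} ∪
            {X : Set α | X ⊆ M.E ∧ M.eRk X = 6}).ncard := ncard_le_ncard hsub (hfin1.union hfin2)
      _ ≤ {X : Set α | X ⊆ (M.ground_finite.toFinset : Set α) ∧ X.ncard ≤ 19}.ncard +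
            {X : Set α | X ⊆ M.E ∧ M.eRk X = 6}.ncard := ncard_union_le _ _
      _ ≤ ∑ j ∈ Finset.range (19 + 1), (p + d).choose j + 2 ^ (39 - 6) * ∑ j ∈ Finset.range (6 + 1), (p + d).choose j := by
          gcongr
          · rw [← hEcard]; exact ncard_subsets_ncard_le _ 19
          · have h39 : ∀ X ⊆ M.E, M.eRk X ≤ 6 → X.ncard ≤ 39 :=
              fun X hX hr => ncard_le_thirtynine_of_eRk_le_six_of_free M hfree hX hr
            have h1 := ncard_eRk_eq_le_choose_mul_of_bound M 6 39 h39
            rw [hEcard] at h1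
            have h2 : (p + d).choose 6 ≤ ∑ j ∈ Finset.range (6 + 1), (p + d).choose j :=
              Finset.single_le_sum (f := fun j => (p + d).choose j) (fun _ _ => Nat.zero_le _) (Finset.self_mem_range_succ 6)
            calc {X : Set α | X ⊆ M.E ∧ M.eRk X = 6}.ncard ≤ (p + d).choose 6 * 2 ^ (39 - 6) := h1
              _ ≤ (∑ j ∈ Finset.range (6 + 1), (p + d).choose j) * 2 ^ (39 - 6) := Nat.mul_le_mul_right _ h2
              _ = 2 ^ (39 - 6) * ∑ j ∈ Finset.range (6 + 1), (p + d).choose j := by ring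
  have hB := Matroid.ncard_spanning_le (M := M) hd
  rw [hEcard] at hY hB
  -- the tails (any of the three forms)
  have hBq : ({X : Set α | X ⊆ M.E ∧ M.eRk X = M.eRank}.ncard : ℚ) ≤
      ∑ j ∈ Finset.range (d + 1), (((p + d).choose j : ℕ) : ℚ) := by exact_mod_cast hB
  have hAq : ({X : Set α | X ⊆ M.E ∧ M.eRk X ≤ 6}.ncard : ℚ) ≤
      ∑ j ∈ Finset.range (a + 1), (((p + d).choose j : ℕ) : ℚ) := by exact_mod_cast hA
  have hA'q : ({X : Set α | X ⊆ M.E ∧ M.eRk X ≤ 6}.ncard : ℚ) ≤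
      ∑ j ∈ Finset.range (19 + 1), (((p + d).choose j : ℕ) : ℚ) +
        2 ^ (39 - 6) * ∑ j ∈ Finset.range (6 + 1), (((p + d).choose j : ℕ) : ℚ) := by exact_mod_cast hA'
  -- the third form: the rank-`≤ 6` sets through the heavy / light count of ALL rank-`6` sets (size cap `min 39 (6 + d)`)
  have hG6 := Matroid.ncard_eRk_eq_ncard_le_le_heavy_tri_cap M 6 (min 19 (5 + d)) ν₁ (by norm_num) hcirc hC1 (min 39 (6 + d))
  have hHv6 := hHvc (min 39 (6 + d))
  have hsub6 : {X : Set α | X ⊆ M.E ∧ M.eRk X = 6}.ncard ≤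
      {B : Set α | B ⊆ M.E ∧ M.eRk B = 6 ∧ B.ncard ≤ min 39 (6 + d)}.ncard := by
    apply ncard_le_ncard
    · intro X hX
      exact ⟨hX.1, hX.2, hflat X hX.1 hX.2.le⟩
    · exact M.ground_finite.finite_subsets.subset (fun X hX => hX.1)
  have hU6q : ({X : Set α | X ⊆ M.E ∧ M.eRk X = 6}.ncard : ℚ) ≤ ((p + d).choose 6 : ℚ) +
      ((∑ i ∈ Finset.range (min 39 (6 + d) - 7 + 1), ((Nat.choose (min (min 19 (5 + d) - 6) (ν₁ - 2)) i : ℕ) : ℚ) * (2 / (((i : ℚ) + 1) * (3 * (i : ℚ) + 2)))) * Pq +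
        ((b : ℕ) : ℚ) * (∑ i ∈ Finset.range (min 39 (6 + d) - 7 + 1), ((Nat.choose (ν₁ - 2) i : ℕ) : ℚ) * (2 / (((i : ℚ) + 1) * (3 * (i : ℚ) + 2)))) * Pq +
        (∑ i ∈ Finset.range (min 39 (6 + d) + 1), ((Nat.choose uG i : ℕ) : ℚ)) +
          (((p + d : ℕ) : ℚ) + 1) * (∑ i ∈ Finset.range (min 39 (6 + d) + 1), ((Nat.choose uH i : ℕ) : ℚ))) := by
    have h1 : ({X : Set α | X ⊆ M.E ∧ M.eRk X = 6}.ncard : ℚ) ≤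
        ({B : Set α | B ⊆ M.E ∧ M.eRk B = 6 ∧ B.ncard ≤ min 39 (6 + d)}.ncard : ℚ) := by exact_mod_cast hsub6
    refine h1.trans (hG6.trans ?_)
    have hσ1' : (0 : ℚ) ≤ ∑ i ∈ Finset.range (min 39 (6 + d) - (6 + 1) + 1),
        ((Nat.choose (min (min 19 (5 + d) - 6) (ν₁ - 2)) i : ℕ) : ℚ) * (2 / (((i : ℚ) + 1) * (3 * (i : ℚ) + 2))) :=
      Finset.sum_nonneg (fun i _ => by positivity)
    have hσ2' : (0 : ℚ) ≤ ∑ i ∈ Finset.range (min 39 (6 + d) - (6 + 1) + 1),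
        ((Nat.choose (ν₁ - 2) i : ℕ) : ℚ) * (2 / (((i : ℚ) + 1) * (3 * (i : ℚ) + 2))) :=
      Finset.sum_nonneg (fun i _ => by positivity)
    have e1 := mul_le_mul_of_nonneg_left (hPs.trans hPexp) hσ1'
    have e2 := mul_le_mul_of_nonneg_left (hPb.trans (mul_le_mul_of_nonneg_left hPexp (by positivity))) hσ2'
    simp only [show (6 : ℕ) + 1 = 7 from rfl] at e1 e2 ⊢
    rw [hn]
    have h3 := add_le_add (add_le_add (add_le_add (le_refl (((p + d).choose 6 : ℕ) : ℚ)) e1) e2) hHv6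
    refine h3.trans (le_of_eq ?_)
    ring
  have hA3q : ({X : Set α | X ⊆ M.E ∧ M.eRk X ≤ 6}.ncard : ℚ) ≤
      (∑ j ∈ Finset.range (min 19 (5 + d) + 1), (((p + d).choose j : ℕ) : ℚ)) +
        (((p + d).choose 6 : ℚ) +
          ((∑ i ∈ Finset.range (min 39 (6 + d) - 7 + 1), ((Nat.choose (min (min 19 (5 + d) - 6) (ν₁ - 2)) i : ℕ) : ℚ) * (2 / (((i : ℚ) + 1) * (3 * (i : ℚ) + 2)))) * Pq +
          ((b : ℕ) : ℚ) * (∑ i ∈ Finset.range (min 39 (6 + d) - 7 + 1), ((Nat.choose (ν₁ - 2) i : ℕ) : ℚ) * (2 / (((i : ℚ) + 1) * (3 * (i : ℚ) + 2)))) * Pq +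
          (∑ i ∈ Finset.range (min 39 (6 + d) + 1), ((Nat.choose uG i : ℕ) : ℚ)) +
          (((p + d : ℕ) : ℚ) + 1) * (∑ i ∈ Finset.range (min 39 (6 + d) + 1), ((Nat.choose uH i : ℕ) : ℚ)))) := by
    have hu := ncard_eRk_le_six_le_small_add M hflat'
    rw [hEcard] at hu
    have huq : ({X : Set α | X ⊆ M.E ∧ M.eRk X ≤ 6}.ncard : ℚ) ≤
        (∑ j ∈ Finset.range (min 19 (5 + d) + 1), (((p + d).choose j : ℕ) : ℚ)) +
          ({X : Set α | X ⊆ M.E ∧ M.eRk X = 6}.ncard : ℚ) := by exact_mod_cast hu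
    linarith [huq, hU6q]
  have hKdq : (0 : ℚ) < (Kd : ℚ) := by exact_mod_cast hKd
  have hABq : ((Kn : ℚ) / (Kd : ℚ)) * (({X : Set α | X ⊆ M.E ∧ M.eRk X ≤ 6}.ncard : ℚ) +
      ({X : Set α | X ⊆ M.E ∧ M.eRk X = M.eRank}.ncard : ℚ)) ≤ 2 ^ (p + d) := by
    rw [div_mul_eq_mul_div, div_le_iff₀ hKdq]
    have hKn0 : (0 : ℚ) ≤ (Kn : ℚ) := Nat.cast_nonneg _
    rcases htail with htail | htail | htail
    · have ht : (Kn : ℚ) * ((∑ j ∈ Finset.range (a + 1), (((p + d).choose j : ℕ) : ℚ)) +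
          ∑ j ∈ Finset.range (d + 1), (((p + d).choose j : ℕ) : ℚ)) ≤ (Kd : ℚ) * 2 ^ (p + d) := by
        exact_mod_cast htail
      linarith [mul_le_mul_of_nonneg_left (add_le_add hAq hBq) hKn0, ht]
    · have ht : (Kn : ℚ) * ((∑ j ∈ Finset.range (19 + 1), (((p + d).choose j : ℕ) : ℚ)) +
          2 ^ (39 - 6) * ∑ j ∈ Finset.range (6 + 1), (((p + d).choose j : ℕ) : ℚ) +
          ∑ j ∈ Finset.range (d + 1), (((p + d).choose j : ℕ) : ℚ)) ≤ (Kd : ℚ) * 2 ^ (p + d) := by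
        exact_mod_cast htail
      linarith [mul_le_mul_of_nonneg_left (add_le_add hA'q hBq) hKn0, ht]
    · rw [hPq] at hA3q
      have h1 := mul_le_mul_of_nonneg_left (add_le_add hA3q hBq) hKn0
      have h2 : (Kn : ℚ) * (({X : Set α | X ⊆ M.E ∧ M.eRk X ≤ 6}.ncard : ℚ) +
          ({X : Set α | X ⊆ M.E ∧ M.eRk X = M.eRank}.ncard : ℚ)) ≤ (Kd : ℚ) * 2 ^ (p + d) := by
        refine h1.trans (le_trans (le_of_eq ?_) htail)
        ring
      linarith [h2]
  -- (Φ) and the polynomial inequality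
  have hΦ := phiK_le_two_pow_div p 6
  rw [Nat.choose_symm_add] at hΦ
  -- assemble in `ℚ`
  rw [RLS_iff]
  have hYq : (2 : ℚ) ^ (p + d) ≤ (Matroid.midCount M p 6 : ℚ) +
      ({X : Set α | X ⊆ M.E ∧ M.eRk X ≤ 6}.ncard : ℚ) +
      ({X : Set α | X ⊆ M.E ∧ M.eRk X = M.eRank}.ncard : ℚ) := by exact_mod_cast hY
  have hU0 : (0 : ℚ) ≤ (Matroid.topCount M p 6 : ℚ) := Nat.cast_nonneg _
  have hd6 : 6 ≤ d := by omega
  have hKq : (0 : ℚ) < (Kn : ℚ) / (Kd : ℚ) := by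
    apply div_pos _ hKdq
    exact_mod_cast (by omega : 0 < Kn)
  have hLq : ((Kn - Kd : ℕ) : ℚ) / (Kd : ℚ) + 1 = (Kn : ℚ) / (Kd : ℚ) := by
    rw [Nat.cast_sub (by omega : Kd ≤ Kn), div_add_one hKdq.ne']
    ring
  have hpoly' : ((Kn : ℚ) / (Kd : ℚ)) * ((((p + d).choose 6 : ℕ) : ℚ) +
      ((∑ i ∈ Finset.range (d - 7 + 1), ((Nat.choose (min (min 19 (5 + d) - 6) (ν₁ - 2)) i : ℕ) : ℚ) * (2 / (((i : ℚ) + 1) * (3 * (i : ℚ) + 2)))) * Pq +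
        ((b : ℕ) : ℚ) * (∑ i ∈ Finset.range (d - 7 + 1), ((Nat.choose (ν₁ - 2) i : ℕ) : ℚ) * (2 / (((i : ℚ) + 1) * (3 * (i : ℚ) + 2)))) * Pq +
        (∑ i ∈ Finset.range (d + 1), ((Nat.choose uG i : ℕ) : ℚ)) +
          (((p + d : ℕ) : ℚ) + 1) * (∑ i ∈ Finset.range (d + 1), ((Nat.choose uH i : ℕ) : ℚ)))) ≤
      (((Kn - Kd : ℕ) : ℚ) / (Kd : ℚ)) * 2 ^ (d - 6) * (((p + 6).choose 6 : ℕ) : ℚ) := by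
    rw [div_mul_eq_mul_div, div_mul_eq_mul_div, div_mul_eq_mul_div]
    exact div_le_div_of_nonneg_right hpoly hKdq.le
  exact level_arith_K (p := p) (d := d) (n := p + d) (q := 6) rfl hd6 hKq hLq hΦ hU0 hUq hYq hABq hpoly'

end ThmN

end PercRepro
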